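/-
Copyright: the b2b-balaban cell (near-miss cell 7), T⁴-continuum fan-out; row NE7b ROUND-2 swarm, seat
t4-ne7b-formalise-leaf-05 gen 4 (row S6g′ INSTANCE of `t4/b2b-balaban-t4-ne7b-p1/LEAVES-NE7b.md`, owner's rulings
R-OWNER-23-3…-7: T3b, file 4 «MEMBER»).  Released under the licence of the surrounding project.
-/
import Summits.QuantumFields.BalabanUV.T4Continuum.Support.HistoryJoinsPlacedContact
import Summits.QuantumFields.BalabanUV.T4Continuum.Support.HistoryZoneMassTotalFlat

/-!
# T3b, file 4 «MEMBER»: a realised member's physical births are the births' reading of a COUNTED placement of the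
# sorted twin (row S6g′ INSTANCE — the map «physical occupant ↦ counted placement»)

Summits-side support leaf of the T⁴-continuum cell (rung (B)+1 on a FINITE torus only; NOT infinite volume, NOT the
mass gap, NOT the Clay statement; NOT a proof of the spine estimate NE7b).  Row NE7b, route «COUNT», row S6g′ INSTANCE,
piece T3b (R-OWNER-23-3 (2), -23-5 (2), -23-6, -23-7).  [folklore] COMPOSITION BY NAME of: leaf-10 gen 6's member
placement `PGen.placed` and its algebra (`HistoryMemberPlacement{,Read,Parts}`: `allJoins_placed_iff`, `rel_placed_subAt`,
`subAt_of_mem_jparts`, `bread_cfg_placed_ne_of_nodup`, `junk_placed_sortR`, `bread_placed_sortR`,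
`evalA_placed_sortR_rootAddr`), its cluster predicate and transport (`HistoryMemberClusterConn`:
`PGen.ClusterConn`, `clusterConn_toPGen_sortR`), leaf-02 gen 6's contact tree and rearrangement
(`HistoryJoinsClusterContact.physTop_of_tconn`∕`tconn_of_tconn_map`, `HistoryJoinsPlacedZoneRead.exists_rearranged_mem_S_zoneP`),
files 1–3a of this piece (`valP`, `zoneP_placed`, `clusterConn_of_realises'`), leaf-07 gen 2's `births_facts_of_corr`,
leaf-08's `Realises`.  Nothing is quoted from print, nothing printed is asserted, no `[cite:]` tag, no `Prop` fact
minted, no definition.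

WHAT.  For a pedigree `P` read «oldest line first» (`HeadOldest`) with renewal dating (`RenewDated`) — the fields
`headOldest`∕`renew_step` of H3's `RealisedDomainsR` — a component `c` whose member `g := P.toPGen cellP c` is REALISED
(`Realises L s R g Z`, `g.lastStep ≤ K`, `P.step c ≤ K`), the run's letters (`3 ≤ L`, `0 < n`, `s` stepwise non-increasing,
drop control), the type bound `tcap d fat ≤ M` on its births, depth `≤ D` of the twin's flat tree, and the DISPLAYED side
condition of R-OWNER-23-6 **`hdis : ((PGen.pbirths g).map (fun bz => (bz.1, valP … bz.1 bz.2))).Nodup`**: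
* §1 structure: `exists_core_of_mem_crootsP` (a join root of a member's flat tree is the flat tree of a JOIN sub-member
  whose parts, births, depth and placement are read inside the member), `fst_mem_births_toGen`,
  `step_le_lastStep_of_realises`, `facts_of_realises`;
* §2 **`allJoins_physTop_sortR`**: the placement `PGen.placed c₀ (valP …) (P.sortR.toPGen cellP c)` of the SORTED twin's
  flat tree `P.sortR.gen c` satisfies leaf-02 gen 6's order-free datum `PhysTop` at every join — clause 1 from the
  realised member's cluster contact (file 3a) TRANSPORTED to the twin (leaf-10 gen 6) and pulled back to the parts
  through file 2's identification of the count's zone with leaf-07 gen 2's region reading; clause 2 from `hdis`;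
* §3 **`exists_mem_S_sortR`**: hence SOME COUNTED placement `P′ ∈ S (zoneP n L K (levelOf s K) 32 c₀) ρ c₀ PEv.step
  (P.sortR.gen c) (valP (root label) (root cell of g))` reads exactly the physical births of `g` through the value map:
  `bread c₀ (P.sortR.gen c) P′ = (PGen.pbirths g).map (fun bz => (bz.1, valP … bz.1 bz.2))` — the occupant key's
  third component (R-OWNER-23-5 (2)); the map «key ↦ P′» is injective on a slot because `bread P′` IS the key's datum.

HONEST SCOPE.  Composition over OUR carriers.  `Realises`∕`HeadOldest`∕`RenewDated` (H3's reading) and `hdis`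
(R-OWNER-23-6, H3-side display «no two constituents of a live component agree as (label, level cell, template)») are
HYPOTHESES; nothing of H3∕(B)∕BetaPertH is discharged; `hmult` is NOT retired by this file (the image count is file 5);
NE7b NOT proved.  HONEST DEPENDENCY (cell): continuum YM on T⁴ ⇐ BetaPertH ∧ nine spine estimates (0/9 proved);
BetaPertH ⇐ (D1) ∧ (D4) ∧ CAP+tail; G-an2-4 gates asym, D1 and NE2/3/4.  This file changes none of it.
-/

open Finset
open Literature.MathematicalPhysics.QuantumFieldTheory.Balaban1983to89
open Literature.MathematicalPhysics.QuantumFieldTheory.Balaban1983to89.B13ScaleTransfer (Pt FaceConnected)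
open Literature.MathematicalPhysics.QuantumFieldTheory.Balaban1983to89.B16SProfile (DropCtl)
open Literature.MathematicalPhysics.QuantumFieldTheory.Balaban1983to89.TreeLength (treeLen)
open T4PersistenceDictionary T4PartnerMultiplicity T4BranchingRecordsGas
open Summit.QuantumFields.BalabanUV.T4Continuum.PlacementSkeleton
open Summit.QuantumFields.BalabanUV.T4Continuum.ZoneTorus
open Summit.QuantumFields.BalabanUV.T4Continuum.ZoneSkeleton
open Summit.QuantumFields.BalabanUV.T4Continuum.HistoryZones
open Summit.QuantumFields.BalabanUV.T4Continuum.HistoryZoneEvolve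
open Summit.QuantumFields.BalabanUV.T4Continuum.HistoryZoneMassPieces
open Summit.QuantumFields.BalabanUV.T4Continuum.HistoryZoneMassJoins
open Summit.QuantumFields.BalabanUV.T4Continuum.HistoryAdmissible
open Summit.QuantumFields.BalabanUV.T4Continuum.HistoryRealise
open Summit.QuantumFields.BalabanUV.T4Continuum.HistoryGen
open Summit.QuantumFields.BalabanUV.T4Continuum.HistoryJoins
open Summit.QuantumFields.BalabanUV.T4Continuum.HistoryJoinsAdm
open Summit.QuantumFields.BalabanUV.T4Continuum.HistoryJoinsTag
open Summit.QuantumFields.BalabanUV.T4Continuum.HistoryJoinsRearrange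
open Summit.QuantumFields.BalabanUV.T4Continuum.HistoryJoinsClusterContact
open Summit.QuantumFields.BalabanUV.T4Continuum.HistoryJoinsPlacedTagged
open Summit.QuantumFields.BalabanUV.T4Continuum.HistoryRegionTemplates
open Summit.QuantumFields.BalabanUV.T4Continuum.HistoryJoinsTemplates
open Summit.QuantumFields.BalabanUV.T4Continuum.HistoryJoinsPlacedZone
open Summit.QuantumFields.BalabanUV.T4Continuum.HistoryJoinsPlacedZoneRead
open Summit.QuantumFields.BalabanUV.T4Continuum.HistoryJoinsPlacedValue
open Summit.QuantumFields.BalabanUV.T4Continuum.HistoryJoinsPlacedPhys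
open Summit.QuantumFields.BalabanUV.T4Continuum.HistoryJoinsPlacedContact
open Summit.QuantumFields.BalabanUV.T4Continuum.HistorySiblingEntropyBridge

namespace Summit.QuantumFields.BalabanUV.T4Continuum.HistoryJoinsPlacedMember

noncomputable section

open scoped Classical

/-! ## §1 Structure: join roots as join sub-members; births of realised members -/

section Structure

variable {γ ν : Type*} {D : ℕ} (c₉ : ν) (w : PEv → γ → ν)

/-- **A JOIN ROOT OF A MEMBER's FLAT TREE IS THE FLAT TREE OF A JOIN SUB-MEMBER** whose non-trivial addresses, births,
birth addresses and placement are read inside the member (renewal wrappers at the root are transparent). [folklore] -/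
theorem exists_core_of_mem_crootsP : ∀ (g : PGen γ) (o : Option ℕ), ∀ q ∈ crootsP PEv.step o g.toGen,
    ∃ A B : PGen γ, ∃ s : ℕ, (PGen.join A B s).toGen = q.2 ∧
      (∀ l : List Bool, l ≠ [] → PGen.subAt g (q.1 ++ l) = PGen.subAt (PGen.join A B s) l) ∧
      (PGen.join A B s).pbirths ≤ g.pbirths ∧
      (∀ b ∈ baddr (PGen.join A B s).toGen, q.1 ++ b ∈ baddr g.toGen) ∧
      PGen.placed (D := D) c₉ w (PGen.subAt g q.1) = PGen.placed c₉ w (PGen.join A B s)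
  | PGen.birth j d z, o, q, hq => by simp [PGen.toGen, crootsP] at hq
  | PGen.renew G h, o, q, hq => by
      have hq' : q ∈ crootsP PEv.step none G.toGen := by simpa [PGen.toGen, crootsP] using hq
      obtain ⟨A, B, s, h1, h2, h3, h4, h5⟩ := exists_core_of_mem_crootsP G none q hq'
      refine ⟨A, B, s, h1, fun l hl => ?_, by simpa using h3, fun b hb => by simpa [PGen.toGen, baddr] using h4 b hb, ?_⟩
      · rw [PGen.subAt_renew_of_ne_nil G h (by simp [hl]), h2 l hl]
      · by_cases hq0 : q.1 = []
        · rw [hq0, PGen.subAt_nil, PGen.placed_renew, ← h5, hq0, PGen.subAt_nil]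
        · rw [PGen.subAt_renew_of_ne_nil G h hq0, h5]
  | PGen.join A' B' s', o, q, hq => by
      simp only [PGen.toGen, crootsP, List.mem_append, List.mem_map] at hq
      rcases hq with hq | ⟨q', hq', rfl⟩ | ⟨q', hq', rfl⟩
      · split_ifs at hq with ho
        · simp at hq
        · rw [List.mem_singleton] at hq
          subst hq
          exact ⟨A', B', s', rfl, fun l _ => rfl, le_rfl, fun b hb => hb, rfl⟩
      · obtain ⟨A, B, s, h1, h2, h3, h4, h5⟩ := exists_core_of_mem_crootsP A' _ q' hq'
        refine ⟨A, B, s, h1, fun l hl => ?_, h3.trans (by simp), fun b hb => ?_, ?_⟩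
        · rw [List.cons_append, PGen.subAt_join_false, h2 l hl]
        · simp only [List.cons_append, PGen.toGen, baddr, mem_union, mem_image]
          exact Or.inl ⟨_, h4 b hb, rfl⟩
        · rw [PGen.subAt_join_false, h5]
      · obtain ⟨A, B, s, h1, h2, h3, h4, h5⟩ := exists_core_of_mem_crootsP B' _ q' hq'
        refine ⟨A, B, s, h1, fun l hl => ?_, h3.trans (by simp), fun b hb => ?_, ?_⟩
        · rw [List.cons_append, PGen.subAt_join_true, h2 l hl]
        · simp only [List.cons_append, PGen.toGen, baddr, mem_union, mem_image]
          exact Or.inr ⟨_, h4 b hb, rfl⟩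
        · rw [PGen.subAt_join_true, h5]

/-- a physical birth's label is a birth label of the flat tree [folklore] -/
theorem fst_mem_births_toGen : ∀ (g : PGen γ) {bz : PEv × γ}, bz ∈ g.pbirths → bz.1 ∈ births g.toGen
  | PGen.birth j d z, bz, h => by simp [PGen.toGen] at h ⊢; rw [h]
  | PGen.renew G k, bz, h => by simpa [PGen.toGen] using fst_mem_births_toGen G (by simpa using h)
  | PGen.join A B s, bz, h => by
      rw [PGen.pbirths_join, Multiset.mem_add] at h
      rw [PGen.toGen, births_merge, mem_union]
      exact h.imp (fst_mem_births_toGen A) (fst_mem_births_toGen B)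

end Structure

section RealisedFacts

variable {d L : ℕ} {sP R : ℕ → ℕ}

/-- **EVERY PHYSICAL BIRTH OF A REALISED MEMBER IS DATED NO LATER THAN ITS LAST STEP.** [folklore] -/
theorem step_le_lastStep_of_realises : ∀ (m : PGen (Pt d × Finset (Pt d))) (Z : Finset (Pt d)),
    Realises L sP R m Z → ∀ bz ∈ m.pbirths, bz.1.step ≤ m.lastStep
  | PGen.birth j cls zZ, Z, _, bz, hbz => by
      simp only [PGen.pbirths_birth, Multiset.mem_singleton] at hbz
      subst hbz; exact le_rfl
  | PGen.renew G h, Z, hR, bz, hbz => by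
      obtain ⟨ZG, hG, hst, -, -⟩ := hR
      have hpos := hst.pos
      have := step_le_lastStep_of_realises G ZG hG bz (by simpa using hbz)
      simp only [PGen.lastStep]; omega
  | PGen.join A B s, Z, hR, bz, hbz => by
      obtain ⟨ZA, ZB, hA, hB, hAt, hBt, -, -, -, -⟩ := hR
      rw [PGen.pbirths_join, Multiset.mem_add] at hbz
      rcases hbz with h | h
      · exact (step_le_lastStep_of_realises A ZA hA bz h).trans hAt
      · exact (step_le_lastStep_of_realises B ZB hB bz h).trans hBt

/-- **THE BIRTH FACTS OF A REALISED MEMBER** (anchor ∈ region, face-connected, `treeLen ≤ fat`) on its physical births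
(leaf-07 gen 2's `births_facts_of_corr` on the payload-tagged tree). [folklore] -/
theorem facts_of_realises {m : PGen (Pt d × Finset (Pt d))} {Z : Finset (Pt d)} (hR : Realises L sP R m Z)
    {bz : PEv × (Pt d × Finset (Pt d))} (hbz : bz ∈ m.pbirths) :
    bz.2.1 ∈ bz.2.2 ∧ FaceConnected bz.2.2 ∧ treeLen bz.2.2 ≤ (bz.1.fat : ℝ) := by
  have hb : bz ∈ births (toGenL m) := by rw [births_toGenL]; exact Multiset.mem_toFinset.2 hbz
  obtain ⟨-, h1, h2, h3⟩ := births_facts_of_corr m (toGenL m) Z (corr_toGenL m) hR bz hb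
  exact ⟨h1, h2, h3⟩

end RealisedFacts

/-! ## §2 The twin's placement satisfies `PhysTop` at every join -/

section Member

variable {α π : Type*} [DecidableEq α] [DecidableEq π] {d n L K D M : ℕ} (P : Pedigree α π)
  (cellP : π → Pt d × Finset (Pt d)) (hN : 0 < n * L ^ K) (hM : 1 ≤ M) (c₀ : TCell d (n * L ^ K) × Template d M)
  {R' : Type*} [LinearOrder R'] (ρ : (Addr D → TCell d (n * L ^ K) × Template d M) → R')
  (hL : 3 ≤ L) (hn : 0 < n) {sP : ℕ → ℕ} (hs : ∀ t, sP (t + 1) ≤ sP t) (hdrop : ∀ m, DropCtl sP m) {Rw : ℕ → ℕ}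
include hL hn hs hdrop

/-- **THE SORTED TWIN's PLACEMENT SATISFIES THE ORDER-FREE DATUM `PhysTop` AT EVERY JOIN** (hence `AllJoins`).
[folklore] -/
theorem allJoins_physTop_sortR (hH : ∀ c, P.HeadOldest c) (hS : P.RenewDated) (c : α) {Z : Finset (Pt d)}
    (hR : Realises L sP Rw (P.toPGen cellP c) Z) (hKg : (P.toPGen cellP c).lastStep ≤ K) (hKc : P.step c ≤ K)
    (hD : ∀ a ∈ baddr (P.sortR.gen c), a.length ≤ D)
    (hMf : ∀ bz ∈ (P.toPGen cellP c).pbirths, tcap d bz.1.fat ≤ M)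
    (hdis : ((P.toPGen cellP c).pbirths.map fun bz => (bz.1, valP n L K hN (levelOf sP K) M hM bz.1 bz.2)).Nodup) :
    AllJoins c₀ PEv.step (PhysTop c₀ PEv.step (zoneP n L K (levelOf sP K) 32 c₀)) (P.sortR.gen c)
      (PGen.placed (D := D) c₀ (valP n L K hN (levelOf sP K) M hM) (P.sortR.toPGen cellP c)) := by
  set lv := levelOf sP K with hlv_def
  have hlv : LevelFn K lv := levelFn_levelOf (fun t _ => hs t) (hdrop K)
  have hL0 : 0 < L := by omega
  set g := P.toPGen cellP c with hg
  set h := P.sortR.toPGen cellP c with hh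
  set V : PEv → Pt d × Finset (Pt d) → TCell d (n * L ^ K) × Template d M := valP n L K hN lv M hM with hV
  have htwin : h.toGen = P.sortR.gen c := P.toGen_toPGen_sortR cellP hS c
  have hpb : h.pbirths = g.pbirths := P.pbirths_toPGen_sortR cellP hH hS c
  have hD' : ∀ a ∈ baddr h.toGen, a.length ≤ D := by rw [htwin]; exact hD
  -- the realised member's letters: birth steps, facts, chronology and dating of the twin's flat tree
  have hsteps : ∀ bz ∈ g.pbirths, lv bz.1.step ≤ K := fun bz hbz =>
    hlv.le_K _ ((step_le_lastStep_of_realises g Z hR bz hbz).trans hKg)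
  have hfacts : ∀ bz ∈ g.pbirths,
      bz.2.1 ∈ bz.2.2 ∧ FaceConnected bz.2.2 ∧ treeLen bz.2.2 ≤ (bz.1.fat : ℝ) ∧ tcap d bz.1.fat ≤ M :=
    fun bz hbz => by
      obtain ⟨h1, h2, h3⟩ := facts_of_realises hR hbz
      exact ⟨h1, h2, h3, hMf bz hbz⟩
  have hchr : Chrono PEv.step h.toGen := by
    rw [htwin]; exact HistoryZoneMassTotalFlat.chronoZ_gen (P := P.sortR) (headOldest_sortR P hH) c
  have hdat : Dated PEv.step true (P.step c + 1) h.toGen := by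
    rw [htwin]
    exact HistoryZoneMassTotalFlat.dated_gen (P := P.sortR) (headOldest_sortR P hH) c (Nat.lt_succ_self _)
  -- the cluster predicate, transported from the realised member to the twin
  have hCC : PGen.ClusterConn (fun t m =>
      regZoneD Prod.fst n L K lv 32 (regR Prod.fst Prod.snd n L K lv) t (toGenL m)) h :=
    P.clusterConn_toPGen_sortR cellP _ hH hS (fun t m m' hmm' => by
      unfold regZoneD coreZoneD; rw [births_toGenL, births_toGenL, hmm']) c
      (clusterConn_of_realises' hL hn hs hdrop hR hKg)
  -- join by join
  rw [← htwin]
  refine (PGen.allJoins_placed_iff c₀ V (PhysTop c₀ PEv.step (zoneP n L K lv 32 c₀)) h hD').2 fun q hq => ?_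
  obtain ⟨A, B, s, hcore, hsub, hpbk, hbad, hpl⟩ := exists_core_of_mem_crootsP c₀ V h none q hq
  rw [hpl]
  have hq2 : q.2 = Gen.merge A.toGen B.toGen ((s, 2, 0) : PEv) := by rw [← hcore]; rfl
  rw [hq2]
  set k := PGen.join A B s with hk
  have hDk : ∀ b ∈ baddr k.toGen, b.length ≤ D := fun b hb => by
    have := hD' _ (hbad b hb); rw [List.length_append] at this; omega
  have hpbk' : k.pbirths ≤ g.pbirths := hpb ▸ hpbk
  -- the join step is at most `K`
  have hsK : lv s ≤ K := by
    have hsub' : Sub (Gen.merge A.toGen B.toGen ((s, 2, 0) : PEv)) h.toGen := by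
      rw [← hq2]; exact sub_of_mem_crootsP PEv.step none h.toGen q hq
    have h1 := (step_le_of_dated_sub hdat hsub').2 rfl
    exact hlv.le_K _ (by simp only [PEv.step_mk] at h1; omega)
  refine physTop_of_tconn PEv.step A.toGen B.toGen ((s, 2, 0) : PEv) c₀ (zoneP n L K lv 32 c₀) ?_ ?_
  · -- clause 1: the part sub-members' zones at the join step are touch-connected
    have hC := hCC q hq
    rw [hq2] at hC
    -- every part: its sub-member, its zone, non-empty
    have hpart : ∀ p ∈ jparts PEv.step (Gen.merge A.toGen B.toGen ((s, 2, 0) : PEv)),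
        zoneP n L K lv 32 c₀ s p.2 (rel c₀ p.1 (PGen.placed (D := D) c₀ V k)) =
          regZoneD Prod.fst n L K lv 32 (regR Prod.fst Prod.snd n L K lv) s (toGenL (PGen.subAt h (q.1 ++ p.1))) ∧
        (regZoneD Prod.fst n L K lv 32 (regR Prod.fst Prod.snd n L K lv) s
          (toGenL (PGen.subAt h (q.1 ++ p.1)))).Nonempty := by
      intro p hp
      have hpk : p ∈ jparts PEv.step k.toGen := hp
      obtain ⟨hna, htoGen⟩ := PGen.subAt_of_mem_jparts hpk
      have hne : p.1 ≠ [] := PGen.fst_ne_nil_of_mem_jparts PEv.step hp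
      have hsa : PGen.subAt h (q.1 ++ p.1) = PGen.subAt k p.1 := hsub p.1 hne
      set k' := PGen.subAt k p.1 with hk'
      have hpbk'' : k'.pbirths ≤ g.pbirths := (PGen.pbirths_subAt_le hna).trans hpbk'
      have hDk' : ∀ b ∈ baddr k'.toGen, b.length ≤ D := fun b hb => by
        have := PGen.depth_subAt hna hDk b hb; omega
      have hz : zoneP n L K lv 32 c₀ s p.2 (rel c₀ p.1 (PGen.placed (D := D) c₀ V k)) =
          regZoneD Prod.fst n L K lv 32 (regR Prod.fst Prod.snd n L K lv) s (toGenL k') := by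
        rw [PGen.rel_placed_subAt c₀ V hna hDk, ← htoGen]
        exact zoneP_placed (c := 32) (c₀ := c₀) hL0 hDk' (fun bz hbz => hsteps bz (Multiset.mem_of_le hpbk'' hbz))
          (fun bz hbz => hfacts bz (Multiset.mem_of_le hpbk'' hbz)) hsK
      refine ⟨by rw [hsa]; exact hz, ?_⟩
      rw [hsa]
      -- non-empty: any birth of the part is a birth of its flat tree `p.2`, dated `≤ s` by chronology
      obtain ⟨bz, hbz, -⟩ := exists_root_pbirth k'
      refine nonempty_regZoneD_toGenL n L K lv 32 hn hL0 hlv ⟨bz, hbz, ?_, ⟨_, (hfacts bz (Multiset.mem_of_le hpbk'' hbz)).1⟩⟩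
      have hsubp : Sub p.2 h.toGen :=
        Sub.trans (sub_of_mem_clusterParts PEv.step _ _ p hp)
          (by rw [← hq2]; exact sub_of_mem_crootsP PEv.step none h.toGen q hq)
      have hchrp : Chrono PEv.step p.2 := chrono_of_sub PEv.step hsubp hchr
      have hft : ftime PEv.step p.2 ≤ s := by
        have h1 := ftime_le_of_sub PEv.step (sub_of_mem_clusterParts PEv.step _ _ p hp)
          (chrono_of_sub PEv.step (by rw [← hq2]; exact sub_of_mem_crootsP PEv.step none h.toGen q hq) hchr)
        exact h1
      have hb : bz.1 ∈ births p.2 := by rw [← htoGen]; exact fst_mem_births_toGen k' hbz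
      exact (step_le_ftime_of_chrono hchrp bz.1 hb).trans hft
    have hT := tconn_of_tconn_map
      (T' := fun A B : Finset (Fin d → ℕ) => (A ∩ B).Nonempty)
      (fun p : List Bool × Gen PEv =>
        regZoneD Prod.fst n L K lv 32 (regR Prod.fst Prod.snd n L K lv) s (toGenL (PGen.subAt h (q.1 ++ p.1))))
      (fun p hp => by rw [inter_self]; exact (hpart p hp).2) hC
    refine TConn.mono (fun p hp p' hp' hpp' => ?_) hT
    have e1 := (hpart p hp).1
    have e2 := (hpart p' hp').1
    simp only [PEv.step_mk]
    rw [e1, e2]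
    exact hpp'
  · -- clause 2: distinct parts read different births, from `hdis`
    intro i j _ hij
    have hdisk : (k.pbirths.map fun bz => (bz.1, V bz.1 bz.2)).Nodup :=
      Multiset.nodup_of_le (Multiset.map_le_map hpbk') hdis
    exact PGen.bread_cfg_placed_ne_of_nodup c₀ V A B s hDk hdisk hij

/-! ## §3 The counted placement reading the member's physical births -/

/-- **ROW S6g′ INSTANCE, T3b — A REALISED MEMBER's PHYSICAL BIRTHS ARE THE BIRTHS' READING OF A COUNTED PLACEMENT OF
ITS SORTED TWIN.**  Under H3's reading conventions (`HeadOldest`, `RenewDated`), the member REALISED along the run and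
pending at a step `≤ K`, the type bound on its fatness classes, the depth of the space, an injective root read-out `ρ`,
and the displayed side condition `hdis` (R-OWNER-23-6): SOME `P′ ∈ S (zoneP n L K (levelOf s K) 32 c₀) ρ c₀ PEv.step
(P.sortR.gen c) (valP (root label) (root cell))` has `bread c₀ (P.sortR.gen c) P′ = (pbirths (P.toPGen cellP c)).map
(label, valP label payload)`. [folklore] -/
theorem exists_mem_S_sortR (hρ : Function.Injective ρ) (hH : ∀ c, P.HeadOldest c) (hS : P.RenewDated) (c : α)
    {Z : Finset (Pt d)} (hR : Realises L sP Rw (P.toPGen cellP c) Z) (hKg : (P.toPGen cellP c).lastStep ≤ K)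
    (hKc : P.step c ≤ K) (hD : ∀ a ∈ baddr (P.sortR.gen c), a.length ≤ D)
    (hMf : ∀ bz ∈ (P.toPGen cellP c).pbirths, tcap d bz.1.fat ≤ M)
    (hdis : ((P.toPGen cellP c).pbirths.map fun bz => (bz.1, valP n L K hN (levelOf sP K) M hM bz.1 bz.2)).Nodup) :
    ∃ P' : Addr D → TCell d (n * L ^ K) × Template d M,
      bread c₀ (P.sortR.gen c) P' =
          (P.toPGen cellP c).pbirths.map (fun bz => (bz.1, valP n L K hN (levelOf sP K) M hM bz.1 bz.2)) ∧
        P' ∈ S (zoneP n L K (levelOf sP K) 32 c₀) ρ c₀ PEv.step (P.sortR.gen c)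
          (valP n L K hN (levelOf sP K) M hM (Gen.root (P.sortR.gen c)) (P.toPGen cellP c).rootCell) := by
  obtain ⟨P', hb, hm⟩ := exists_rearranged_mem_S_zoneP (c := 32) (c₀ := c₀) hρ PEv.step hD
    (P.junk_placed_sortR cellP c₀ _ hS c)
    (allJoins_physTop_sortR P cellP hN hM c₀ hL hn hs hdrop hH hS c hR hKg hKc hD hMf hdis)
  refine ⟨P', ?_, ?_⟩
  · rw [hb, P.bread_placed_sortR cellP c₀ _ hH hS c hD]
  · rwa [P.evalA_placed_sortR_rootAddr cellP c₀ _ hH hS c hD] at hm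

end Member

end

end Summit.QuantumFields.BalabanUV.T4Continuum.HistoryJoinsPlacedMember
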